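import Literature.Analysis.FluidPDE.KNSSDriftConstantMorrey
import Literature.Analysis.FluidPDE.SuitableWeakBoundedWindow
import Literature.Analysis.FluidPDE.KNSSWeakDriftMildProofs
import Literature.Analysis.FluidPDE.ChaeWolfLocalLeray
import Literature.Analysis.FluidPDE.TypeIAncientMild
import Literature.Analysis.UnboundedOperators.HeatFlowCalculus
import HarnessLib

/-!
# Continuous Oseen-mild representatives of bounded suitable weak solutions on a window

Analysis/FluidPDE proof file (theorems only; no definitions, no named facts).

**Main result** (`exists_oseenMild_repr_window`). Let `(u, p)` be a suitable weak solution of the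
unforced Navier–Stokes system (`ν = 1`) on the open slab `(a, c) × ℝ³`, pointwise bounded there, and
suppose almost every slice obeys the scale-invariant Morrey bound at the origin at all large integer
radii, `∫_{B_m(0)} ‖u(t)‖² ≤ I m` (`m ≥ m₀`) — which is what Albritton–Barker's `𝐈 < ∞` provides
(`ae_energy_ball_le_typeIBound`). Then `u` is a.e. equal on `(a, c) × ℝ³` to a field `v` which is
continuous on the open slab, has weakly divergence-free slices at EVERY time of `(a, c)`, and solves
the Oseen integral equation `v(t) = e^{(t−s)Δ}v(s) − B¹ₛ(v, v)(t)` pointwise for all `a < s < t < c`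
— a bounded mild solution in the sense of Koch–Nadirashvili–Seregin–Šverák 2009, §4 (i). This is the
mildness step of the forward direction of Albritton–Barker 2019, Thm. 1.1 (the blow-up limit "is a
mild bounded ancient solution", via Seregin–Šverák 2009, Thm. 2.8), proved here directly at the level
of the given solution:

1. `u(a + ·)` is a bounded weak solution of KNSS on `(0, c − a)`
   (`IsSuitableWeakSolutionOn.isBoundedWeakNSSolutionOn_timeShift_of_bound`);
2. KNSS's Lemma 3.1 (`KNSS2009_weak_driftMild_holds`) writes it as `U + b(t)` a.e., `(U, b)` drift-mild;
3. the Morrey bound kills the drift (`IsKNSSDriftMild.exists_zeroDrift_of_morrey`,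
   `KNSSDriftConstantMorrey.lean`): `u(a + ·) = V` a.e. with `V` drift-mild with zero drift;
4. zero-drift drift-mild fields are jointly continuous (`IsKNSSDriftMild.continuousOn_uncurry`: caloric
   term plus jointly continuous Duhamel term), have weakly divergence-free slices at every time
   (`IsKNSSDriftMild.isWeaklyDivFree_of_mem`: the a.e. property is closed under bounded pointwise
   limits), and solve the Oseen equation with the tree's kernel-realised Duhamel term
   (`IsKNSSDriftMild.eq_heatExtension_sub_oseenDuhamel_three`);
5. translate back in time (`oseenDuhamel_comp_sub_right`); slice-wise a.e. equality is a.e. equality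
   on the strip (`ae_eq_prod_of_ae_slice_ae_eq`).

## References

* D. Albritton, T. Barker, *On local Type I singularities of the Navier–Stokes equations and
  Liouville theorems*, J. Math. Fluid Mech. 21 (2019) = arXiv:1811.00502, Thm. 1.1, §3.
  [AlbrittonBarker2019]
* G. Koch, N. Nadirashvili, G. Seregin, V. Šverák, Acta Math. 203 (2009) = arXiv:0709.3599, Lemma
  3.1, Remark 3.1, §4 (i)–(ii). [KochNadirashviliSereginSverak2009]
* G. Seregin, V. Šverák, Comm. PDE 34 (2009) = arXiv:0804.1803, Thm. 2.8. [SereginSverak2009]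
-/

noncomputable section

open MeasureTheory Set Function Filter Metric TopologicalSpace
open _root_.Topology
open scoped NNReal ENNReal RealInnerProductSpace

namespace Literature.Analysis.FluidPDE

/-- Local notation for physical space `ℝ³ = EuclideanSpace ℝ (Fin 3)`. -/
local notation "ℝ³" => EuclideanSpace ℝ (Fin 3)

/-! ### Drift-mild fields: joint continuity, divergence-free slices at every time -/

section DriftMild

variable {T N : ℝ} {U : ℝ → ℝ³ → ℝ³} {b : ℝ → ℝ³}

/-- **A drift-mild field is jointly continuous on its open window**: on `(τ₀/2, T) × ℝ³` it is the
caloric extension of the bounded slice `U(τ₀/2)` (jointly continuous,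
`continuousOn_uncurry_heatExtension_of_memLp`) minus the jointly continuous Duhamel term
(`IsKNSSDriftMild.continuousOn_driftDuhamel_prod`). [folklore] -/
theorem IsKNSSDriftMild.continuousOn_uncurry (h : IsKNSSDriftMild T N U b) :
    ContinuousOn (uncurry U) (Ioo 0 T ×ˢ univ) := by
  have hE : Module.finrank ℝ ℝ³ = 3 := finrank_euclideanSpace_fin
  rintro ⟨τ₀, x₀⟩ ⟨hτ₀, -⟩
  have hs : 0 < τ₀ / 2 := by linarith [hτ₀.1]
  have hsT : τ₀ / 2 < T := by linarith [hτ₀.1, hτ₀.2]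
  -- the representation on `(τ₀/2, T) × ℝ³`
  have hrep : EqOn (uncurry U)
      (fun q : ℝ × ℝ³ => UnboundedOperators.heatExtension (U (τ₀ / 2)) (q.1 - τ₀ / 2) q.2 -
        driftDuhamel U b (τ₀ / 2) q.1 q.2) (Ioo (τ₀ / 2) T ×ˢ univ) :=
    fun q hq => h.mild (τ₀ / 2) q.1 hs hq.1.1 hq.1.2 q.2
  have h1 : ContinuousOn (fun q : ℝ × ℝ³ => UnboundedOperators.heatExtension (U (τ₀ / 2)) (q.1 - τ₀ / 2) q.2)
      (Ioo (τ₀ / 2) T ×ˢ univ) := by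
    have hc := UnboundedOperators.continuousOn_uncurry_heatExtension_of_memLp
      (h.memLp_top_slice ⟨hs, hsT⟩) le_top
    refine hc.comp (f := fun q : ℝ × ℝ³ => (q.1 - τ₀ / 2, q.2))
      ((continuous_fst.sub continuous_const).prodMk continuous_snd).continuousOn ?_
    intro q hq
    exact ⟨mem_Ioi.2 (sub_pos.2 hq.1.1), mem_univ _⟩
  have h2 : ContinuousOn (fun q : ℝ × ℝ³ => driftDuhamel U b (τ₀ / 2) q.1 q.2) (Ioo (τ₀ / 2) T ×ˢ univ) :=
    (h.continuousOn_driftDuhamel_prod hE hs.le).mono (prod_mono Ioo_subset_Icc_self Subset.rfl)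
  have h3 : ContinuousOn (uncurry U) (Ioo (τ₀ / 2) T ×ˢ univ) := (h1.sub h2).congr hrep
  exact (h3.continuousAt ((isOpen_Ioo.prod isOpen_univ).mem_nhds
    ⟨⟨by linarith [hτ₀.1], hτ₀.2⟩, mem_univ _⟩)).continuousWithinAt

/-- **Every slice of a drift-mild field in the open window is weakly divergence free** (not only
almost every one): the good times are dense, the field is jointly continuous and bounded, and the
condition `∫ ⟪U(τ), ∇θ⟫ = 0` passes to bounded pointwise limits (dominated convergence). [folklore] -/
theorem IsKNSSDriftMild.isWeaklyDivFree_of_mem (h : IsKNSSDriftMild T N U b) {τ : ℝ}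
    (hτ : τ ∈ Ioo 0 T) : IsWeaklyDivFree (U τ) := by
  have hE : Module.finrank ℝ ℝ³ = 3 := finrank_euclideanSpace_fin
  -- the dense set of good times
  set Gd : Set ℝ := {σ | σ ∈ Ioo 0 T → IsWeaklyDivFree (U σ)} with hGd
  have hgood : ∀ᵐ σ ∂(volume : Measure ℝ), σ ∈ Gd :=
    (ae_restrict_iff' (measurableSet_Ioo (a := (0 : ℝ)) (b := T))).1 h.ae_isWeaklyDivFree
  have hdense : Dense Gd := Measure.dense_of_ae hgood
  have hsub := hdense.open_subset_closure_inter (isOpen_Ioo (a := (0 : ℝ)) (b := T))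
  obtain ⟨tq, htq, htql⟩ := mem_closure_iff_seq_limit.1 (hsub hτ)
  intro θ hθ
  have hθ1 : ContDiff ℝ 1 θ := contDiff_infty.1 hθ.contDiff 1
  have hgc : HasCompactSupport (gradient θ) := by
    have : gradient θ = (fun L => (InnerProductSpace.toDual ℝ ℝ³).symm L) ∘ fderiv ℝ θ := rfl
    rw [this]
    exact (hθ.hasCompactSupport.fderiv (𝕜 := ℝ)).comp_left (by simp)
  have hθi : Integrable (fun x => N * ‖gradient θ x‖) volume :=
    (((continuous_gradient_of_contDiff hθ1).integrable_of_hasCompactSupport hgc).norm).const_mul N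
  have hcont := h.continuousOn_uncurry
  have hlim : Tendsto (fun n => ∫ x, ⟪U (tq n) x, gradient θ x⟫) atTop
      (𝓝 (∫ x, ⟪U τ x, gradient θ x⟫)) := by
    refine tendsto_integral_of_dominated_convergence (fun x => N * ‖gradient θ x‖)
      (fun n => ((h.continuous_slice hE (htq n).1).inner
        (continuous_gradient_of_contDiff hθ1)).aestronglyMeasurable) hθi
      (fun n => Eventually.of_forall fun x => (norm_inner_le_norm _ _).trans
        (mul_le_mul_of_nonneg_right (h.norm_le _ (htq n).1 x) (norm_nonneg _)))
      (Eventually.of_forall fun x => ?_)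
    have hca : ContinuousAt (uncurry U) (τ, x) :=
      hcont.continuousAt ((isOpen_Ioo.prod isOpen_univ).mem_nhds ⟨hτ, mem_univ x⟩)
    have h1 : Tendsto (fun n => U (tq n) x) atTop (𝓝 (U τ x)) :=
      hca.tendsto.comp (htql.prodMk_nhds tendsto_const_nhds)
    exact h1.inner tendsto_const_nhds
  have hzero : ∀ n, ∫ x, ⟪U (tq n) x, gradient θ x⟫ = 0 := fun n => (htq n).2 (htq n).1 θ hθ
  simp_rw [hzero] at hlim
  exact tendsto_nhds_unique hlim tendsto_const_nhds

end DriftMild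

/-! ### The window representative -/

section Window

variable {u : ℝ → ℝ³ → ℝ³} {p : ℝ → ℝ³ → ℝ}

/-- **Continuous Oseen-mild representative of a bounded suitable weak solution with the Morrey
bound, on a window** (Albritton–Barker 2019, forward direction of Thm. 1.1, mildness step; KNSS 2009,
Lemma 3.1 and §4). Let `(u, p)` be a suitable weak solution (`ν = 1`, no force) on `(a, c) × ℝ³`
with `‖u(t, x)‖ ≤ M` there, and suppose `∫_{B_m(0)} ‖u(t)‖² ≤ I m` for all integers `m ≥ m₀` at
a.e. `t ∈ (a, c)`. Then there is `v : ℝ → ℝ³ → ℝ³`, continuous on `(a, c) × ℝ³`, with weakly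
divergence-free slices at every `t ∈ (a, c)`, solving
`v(t, x) = e^{(t−s)Δ}v(s)(x) − B¹ₛ(v, v)(t)(x)` for all `a < s < t < c` and all `x`, and equal to
`u` almost everywhere on `(a, c) × ℝ³` (module docstring, steps 1–5).
[cite: AlbrittonBarker2019, Thm 1.1 (forward direction, §3), with KochNadirashviliSereginSverak2009, Lemma 3.1 and §4 (i)–(ii) (arXiv pp. 7–8)] -/
theorem exists_oseenMild_repr_window {a c : ℝ} (hac : a < c)
    (hsw : IsSuitableWeakSolutionOn (slab ℝ³ (Ioo a c) isOpen_Ioo) 1 0 u p)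
    {M : ℝ} (hM : ∀ t ∈ Ioo a c, ∀ x, ‖u t x‖ ≤ M)
    {I : ℝ} (hI : 0 ≤ I) {m₀ : ℕ}
    (hMor : ∀ᵐ t ∂(volume.restrict (Ioo a c)), ∀ m : ℕ, m₀ ≤ m →
      ∫⁻ y in ball (0 : ℝ³) m, ‖u t y‖ₑ ^ 2 ≤ ENNReal.ofReal (I * m)) :
    ∃ v : ℝ → ℝ³ → ℝ³,
      ContinuousOn (uncurry v) (Ioo a c ×ˢ univ) ∧
      (∀ t ∈ Ioo a c, IsWeaklyDivFree (v t)) ∧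
      (∀ s t : ℝ, a < s → s < t → t < c → ∀ x,
        v t x = UnboundedOperators.heatExtension (v s) (t - s) x - oseenDuhamel 1 s v v t x) ∧
      (∀ᵐ z ∂(volume.restrict (Ioo a c ×ˢ (univ : Set ℝ³))), uncurry u z = uncurry v z) := by
  set T : ℝ := c - a with hT
  have hT0 : 0 < T := sub_pos.2 hac
  -- ## Step 1: the translate `u(a + ·)` is a bounded weak solution on `(0, T)`
  set ua : ℝ → ℝ³ → ℝ³ := fun s y => u (a + s) y with hua
  have hbw : IsBoundedWeakNSSolutionOn (Ioo 0 T) isOpen_Ioo 1 ua :=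
    hsw.isBoundedWeakNSSolutionOn_timeShift_of_bound hM
  have hMa : ∀ s ∈ Ioo 0 T, ∀ y, ‖ua s y‖ ≤ M := fun s hs' y =>
    hM (a + s) ⟨by linarith [hs'.1], by linarith [hs'.2]⟩ y
  -- ## Step 2: Lemma 3.1
  obtain ⟨N, hN⟩ := KNSS2009_weak_driftMild_holds M T hT0
  obtain ⟨U, b, hUb, hae⟩ := hN hbw hMa
  -- ## Step 3: the Morrey bound, transported to `U + b`, kills the drift
  have hMor' : ∀ᵐ τ ∂(volume.restrict (Ioo 0 T)), ∀ m : ℕ, m₀ ≤ m →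
      ∫⁻ y in ball (0 : ℝ³) m, ‖U τ y + b τ‖ₑ ^ 2 ≤ ENNReal.ofReal (I * m) := by
    have h1 := (ae_restrict_iff' (measurableSet_Ioo (a := a) (b := c))).1 hMor
    have h2 := (measurePreserving_add_left (volume : Measure ℝ) a).quasiMeasurePreserving.ae h1
    have h3 : ∀ᵐ τ ∂(volume.restrict (Ioo 0 T)), ∀ m : ℕ, m₀ ≤ m →
        ∫⁻ y in ball (0 : ℝ³) m, ‖ua τ y‖ₑ ^ 2 ≤ ENNReal.ofReal (I * m) := by
      refine (ae_restrict_iff' measurableSet_Ioo).2 (h2.mono fun τ hτ hτI => ?_)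
      exact hτ ⟨by linarith [hτI.1], by linarith [hτI.2]⟩
    filter_upwards [h3, hae] with τ hτ hτae m hm
    have e : ∫⁻ y in ball (0 : ℝ³) m, ‖U τ y + b τ‖ₑ ^ 2 = ∫⁻ y in ball (0 : ℝ³) m, ‖ua τ y‖ₑ ^ 2 :=
      lintegral_congr_ae (ae_restrict_of_ae (hτae.mono fun y hy => by
        show ‖U τ y + b τ‖ₑ ^ 2 = ‖ua τ y‖ₑ ^ 2
        rw [hy]))
    rw [e]
    exact hτ m hm
  obtain ⟨V, hV, hVae⟩ := hUb.exists_zeroDrift_of_morrey hI hMor'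
  -- `ua(τ) = V(τ)` a.e. in space for a.e. `τ`, hence a.e. on the strip
  have hslice : ∀ᵐ τ ∂(volume.restrict (Ioo 0 T)), ua τ =ᵐ[volume] V τ := by
    filter_upwards [hae, hVae] with τ h1 h2
    exact h1.mono fun y hy => by
      show ua τ y = V τ y
      rw [hy]
      exact h2 y
  have hstrip : uncurry ua =ᵐ[volume.restrict (Ioo 0 T ×ˢ (univ : Set ℝ³))] uncurry V := by
    have hm1 : AEStronglyMeasurable (uncurry ua)
        (((volume : Measure ℝ).restrict (Ioo 0 T)).prod (volume : Measure ℝ³)) := by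
      have h := hbw.aestronglyMeasurable
      rwa [volume_restrict_slab_eq] at h
    have hm2 : AEStronglyMeasurable (uncurry V)
        (((volume : Measure ℝ).restrict (Ioo 0 T)).prod (volume : Measure ℝ³)) :=
      hV.measurable.aestronglyMeasurable
    rw [volume_restrict_slab_eq]
    exact ae_eq_prod_of_ae_slice_ae_eq hm1 hm2 hslice
  -- ## Steps 4–5: the representative in the original time variable
  set v : ℝ → ℝ³ → ℝ³ := fun t x => V (t - a) x with hv
  refine ⟨v, ?_, ?_, ?_, ?_⟩
  · -- joint continuity
    refine hV.continuousOn_uncurry.comp (f := fun q : ℝ × ℝ³ => (q.1 - a, q.2))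
      ((continuous_fst.sub continuous_const).prodMk continuous_snd).continuousOn ?_
    intro q hq
    exact ⟨⟨sub_pos.2 hq.1.1, by rw [hT]; linarith [hq.1.2]⟩, mem_univ _⟩
  · -- weakly divergence-free slices at every time
    intro t ht
    exact hV.isWeaklyDivFree_of_mem ⟨sub_pos.2 ht.1, by rw [hT]; linarith [ht.2]⟩
  · -- the Oseen identity
    intro s t has hst htc x
    have h1 := (hV.eq_heatExtension_sub_oseenDuhamel_three (s := s - a) (t := t - a)
      (sub_pos.2 has) (by linarith) (by rw [hT]; linarith)).1 x
    rw [show t - a - (s - a) = t - s by ring] at h1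
    show V (t - a) x = UnboundedOperators.heatExtension (V (s - a)) (t - s) x -
      oseenDuhamel 1 s (fun τ => V (τ - a)) (fun τ => V (τ - a)) t x
    rw [oseenDuhamel_comp_sub_right]
    exact h1
  · -- `u = v` a.e. on the strip: transport `hstrip` by `(t, x) ↦ (t − a, x)`
    have h1 := (ae_restrict_iff' (measurableSet_Ioo.prod MeasurableSet.univ)).1 hstrip
    have hmp : MeasurePreserving (Prod.map (fun t : ℝ => t - a) (id : ℝ³ → ℝ³))
        (volume : Measure (ℝ × ℝ³)) (volume : Measure (ℝ × ℝ³)) := by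
      rw [Measure.volume_eq_prod]
      exact (measurePreserving_sub_right (volume : Measure ℝ) a).prod (MeasurePreserving.id volume)
    have h2 := hmp.quasiMeasurePreserving.ae h1
    refine (ae_restrict_iff' (measurableSet_Ioo.prod MeasurableSet.univ)).2 (h2.mono fun w hw hwI => ?_)
    have hmem : Prod.map (fun t : ℝ => t - a) (id : ℝ³ → ℝ³) w ∈ Ioo 0 T ×ˢ (univ : Set ℝ³) := by
      refine ⟨⟨?_, ?_⟩, mem_univ _⟩
      · show 0 < w.1 - a
        linarith [hwI.1.1]
      · show w.1 - a < T
        rw [hT]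
        linarith [hwI.1.2]
    have h3 := hw hmem
    simp only [uncurry, Prod.map, id, hua, add_sub_cancel] at h3
    simpa only [uncurry, hv] using h3

end Window

end Literature.Analysis.FluidPDE

end
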